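import Summits.QuantumFields.BalabanUV.Beta.RootedMixedJetLinear
import Summits.QuantumFields.BalabanUV.Beta.RootedJetTwist
import Literature.MathematicalPhysics.QuantumFieldTheory.Balaban1983to89.Beta.RootedKernelReflection

/-!
# `BalabanUV.Beta.RootedMixedJetSigns` — binder row D1, AVG-LETTERS chain, MIXED sub-chain «MX3»: NATURALITY OF THE MIXED CHART IN THE
# LETTER ALGEBRA, ODDNESS OF THE MIXED JET IN EACH FLUCTUATION LETTER, AND ELEMENTARY LETTERS UNDER THE SIGNED PULL-BACK `R1g`
# (β sub-cell, D1 formalisation swarm, leaf-05 gen 7; CUT for an3-g33's M3 extraction step)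

HONEST FRAMING (cell charter, verbatim): «discharging BetaPertH makes Balaban's UV stability UNCONDITIONAL — a real
constructive-QFT result; it is NOT the continuum limit and NOT the Clay problem.»
HONEST DEPENDENCY: continuum YM on T⁴ ⇐ BetaPertH ∧ nine spine estimates (0/9 proved); BetaPertH ⇐ (D1) ∧ (D4) ∧ CAP+tail;
G-an2-4 gates asym, D1 and NE2/3/4.
DERIVED cell leaf ([folklore] ring algebra over node 12b `AveragingMixedJetTables` (`Zf`, `Zb`, `MjetAt`, `map_PhiGAt`), leaf-05's MX1
`RootedMixedChartReflection` (`GmL`, `GmbL`, `PhiMLAt`, `MσLAt`), an3-g33's 33M1 `RootedMixedJetLinear` (`MσGAt`) and 33H `RootedJetTwist`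
(`flip1`, reused BY NAME), an1's M1 `RootedHolonomyReflection` (`R1g`), an5's `fref`).  No statement of Bałaban's papers, no `[cite:]`, no
`Prop` is minted; the data definition `flip2` is [our object].  Proves NO table identity and NO letter; instantiates NO binder of the wall
(0∕4: hW, hR, D1Tel, D1Rep).  NOT D1, NOT BetaPertH, NOT continuum, NOT Clay.

## What is here
* §1 NATURALITY under any algebra map `F : Tau R →ₐ[𝕜] Tau R′` of the letter algebra: `mapDual_GmL`, `mapDual_GmbL`, `map_PhiMLAt`,
  **`map_MσGAt`**, **`map_MσLAt`**, `map_MjetLAt_eq` (the mixed twins of 33H's `map_QjetLAt`).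
* §2 THE `τ₂`-FLIP `flip2` (`c01`, `c11 ↦ −`; `c00`, `c10` fixed) next to 33H's `τ₁`-flip `flip1`; `flip1_Zf = Zf (−W) V`, `flip1_Zb`,
  `flip2_Zf = Zf W (−V)`, `flip2_Zb`; hence **`MjetAt_neg_W`**, **`MjetAt_neg_V`**: with 33M1's `MjetAt_neg_B` the mixed jet is ODD in each
  of its three letters separately.
* §3 ELEMENTARY LETTERS: **`R1g_single : R1g α (single f c) = single (fref α f) (if f.1 = α then −c else c)`** (generic coefficients; twin
  of an5's real `R1_single`), `R1g_add/_neg/_sub`, `R1g_R1g` (involution; `R1g_zero` is an3's 33M2), `upF_single`, `upF_R1g`.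
Provenance: β sub-cell, D1 formalisation swarm, unit b2b-balaban-beta-d1-formalise-leaf-05 gen 7, 2026-08-20 (v1); no existing file touched.
-/

namespace Summit.QuantumFields.BalabanUV.Beta.RootedMixedJetSigns

open Literature.MathematicalPhysics.QuantumFieldTheory.Balaban1983to89
open Literature.MathematicalPhysics.QuantumFieldTheory.Balaban1983to89.Beta
open AffineAveraging (Form1)
open AveragingHessianKernels (Bond single single_apply)
open AveragingThirdJet (Tau Rho dmk fst_dmk snd_dmk dfst_mul dsnd_mul mapDual fst_mapDual snd_mapDual scaleDual fst_scaleDual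
  snd_scaleDual upF upF_apply logT invT map_logT map_invT)
open AveragingThirdJet.Tau (τ₁ τ₂ τ12 ι c00 c10 c01 c11 ext4)
open AveragingMixedJetTables (PhiGAt map_PhiGAt Zf Zb PhiMAt MjetAt)
open ResolventReflection (bref bref_bref)
open RootedKernelReflection (fref)
open Summit.QuantumFields.BalabanUV.Beta.RootedHolonomyReflection (R1g)
open Summit.QuantumFields.BalabanUV.Beta.RootedMixedChartReflection (GmL GmbL PhiMLAt MσLAt MjetLAt MjetLAt_eq_c11 PhiMAt_eq_PhiMLAt
  MjetAt_eq_MjetLAt)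
open Summit.QuantumFields.BalabanUV.Beta.RootedMixedJetLinear (MσGAt)
open Summit.QuantumFields.BalabanUV.Beta.RootedJetTwist (flip1 c00_flip1 c10_flip1 c01_flip1 c11_flip1 flip1_ι)

variable {𝕜 : Type*} [Field 𝕜] {d : ℕ} {𝔸 : Type*} [Ring 𝔸] [Algebra 𝕜 𝔸]

/-! ## §1 Naturality of the mixed chart in the letter algebra -/

section Naturality

variable {R R' : Type*} [Ring R] [Algebra 𝕜 R] [Ring R'] [Algebra 𝕜 R'] (F : Tau R →ₐ[𝕜] Tau R')

/-- [folklore] The forward mixed letter under a map of the letter algebra. -/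
theorem mapDual_GmL (Z b : Form1 d (Tau R)) (κ : Fin d) (x : Fin d → ℤ) :
    mapDual F (GmL Z b κ x) = GmL (fun κ x => F (Z κ x)) (fun κ x => F (b κ x)) κ x := by
  rw [GmL, GmL, map_mul]
  congr 1 <;> exact TrivSqZeroExt.ext (by simp) (by simp)

/-- [folklore] The backward mixed letter under a map of the letter algebra. -/
theorem mapDual_GmbL (Zb' b : Form1 d (Tau R)) (κ : Fin d) (x : Fin d → ℤ) :
    mapDual F (GmbL Zb' b κ x) = GmbL (fun κ x => F (Zb' κ x)) (fun κ x => F (b κ x)) κ x := by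
  rw [GmbL, GmbL, map_mul]
  congr 1 <;> exact TrivSqZeroExt.ext (by simp) (by simp [map_neg])

/-- [folklore] **NATURALITY OF THE ROOTED MIXED AVERAGING**: `mapDual F (Φ^L(Z, Z̄′, b)) = Φ^L(F∘Z, F∘Z̄′, F∘b)`. -/
theorem map_PhiMLAt (ρ : Fin d → ℤ) (Z Zb' b : Form1 d (Tau R)) (L : ℕ) (μ : Fin d) (y : Fin d → ℤ) :
    mapDual F (PhiMLAt 𝕜 ρ Z Zb' b L μ y)
      = PhiMLAt 𝕜 ρ (fun κ x => F (Z κ x)) (fun κ x => F (Zb' κ x)) (fun κ x => F (b κ x)) L μ y := by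
  unfold PhiMLAt
  rw [map_PhiGAt]
  simp only [mapDual_GmL, mapDual_GmbL]

set_option synthInstance.maxHeartbeats 200000 in
set_option maxHeartbeats 1600000 in
/-- [folklore] **NATURALITY OF THE TWO-BACKGROUND σ-JET**: `F (MσGAt Z Z̄′ b Z₀ Z̄₀ c) = MσGAt (F∘Z) (F∘Z̄′) (F∘b) (F∘Z₀) (F∘Z̄₀) (F∘c)`. -/
theorem map_MσGAt (ρ : Fin d → ℤ) (Z Zb' b Z₀ Zb₀ c : Form1 d (Tau R)) (L : ℕ) (μ : Fin d) (y : Fin d → ℤ) :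
    F (MσGAt 𝕜 ρ Z Zb' b Z₀ Zb₀ c L μ y)
      = MσGAt 𝕜 ρ (fun κ x => F (Z κ x)) (fun κ x => F (Zb' κ x)) (fun κ x => F (b κ x))
          (fun κ x => F (Z₀ κ x)) (fun κ x => F (Zb₀ κ x)) (fun κ x => F (c κ x)) L μ y := by
  unfold MσGAt
  have key := congrArg TrivSqZeroExt.snd (map_logT (mapDual F)
    (PhiMLAt 𝕜 ρ Z Zb' b L μ y * invT (PhiMLAt 𝕜 ρ Z₀ Zb₀ c L μ y)))
  simp only [map_mul, map_invT, map_PhiMLAt, snd_mapDual] at key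
  exact key

/-- [folklore] **NATURALITY OF THE σ-JET** `MσLAt` (common background). -/
theorem map_MσLAt (ρ : Fin d → ℤ) (Z Zb' Z₀ Zb₀ b : Form1 d (Tau R)) (L : ℕ) (μ : Fin d) (y : Fin d → ℤ) :
    F (MσLAt 𝕜 ρ Z Zb' Z₀ Zb₀ b L μ y)
      = MσLAt 𝕜 ρ (fun κ x => F (Z κ x)) (fun κ x => F (Zb' κ x)) (fun κ x => F (Z₀ κ x)) (fun κ x => F (Zb₀ κ x))
          (fun κ x => F (b κ x)) L μ y :=
  map_MσGAt F ρ Z Zb' b Z₀ Zb₀ b L μ y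

/-- [folklore] The mixed jet under a map of the letter algebra, read through `c11 ∘ F`. -/
theorem map_MjetLAt_eq (ρ : Fin d → ℤ) (Z Zb' Z₀ Zb₀ b : Form1 d (Tau R)) (L : ℕ) (μ : Fin d) (y : Fin d → ℤ) :
    MjetLAt 𝕜 ρ (fun κ x => F (Z κ x)) (fun κ x => F (Zb' κ x)) (fun κ x => F (Z₀ κ x)) (fun κ x => F (Zb₀ κ x))
        (fun κ x => F (b κ x)) L μ y = c11 (F (MσLAt 𝕜 ρ Z Zb' Z₀ Zb₀ b L μ y)) := by
  rw [MjetLAt_eq_c11, map_MσLAt]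

end Naturality

/-! ## §2 The `τ₂`-flip and the oddness of the mixed jet in each fluctuation letter -/

section Flips

variable (𝕜)

/-- [our object] THE `τ₂`-SIGN FLIP `τ₂ ↦ −τ₂` (`τ₁` fixed, `τ₁τ₂ ↦ −τ₁τ₂`): `mk a b c e ↦ mk a b (−c) (−e)`. -/
def flip2 : Tau 𝔸 →ₐ[𝕜] Tau 𝔸 :=
  scaleDual (𝕜 := 𝕜) (dmk (-1 : 𝔸) 0) fun t => TrivSqZeroExt.ext (by simp) (by simp)

variable {𝕜}

/-- [folklore] Components of the `τ₂`-flip. -/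
@[simp] theorem c00_flip2 (q : Tau 𝔸) : c00 (flip2 𝕜 q) = c00 q := rfl
/-- [folklore] -/
@[simp] theorem c10_flip2 (q : Tau 𝔸) : c10 (flip2 𝕜 q) = c10 q := rfl
/-- [folklore] -/
@[simp] theorem c01_flip2 (q : Tau 𝔸) : c01 (flip2 𝕜 q) = -c01 q := by
  show (dmk (-1 : 𝔸) 0 * q.snd).fst = -q.snd.fst
  simp
/-- [folklore] -/
@[simp] theorem c11_flip2 (q : Tau 𝔸) : c11 (flip2 𝕜 q) = -c11 q := by
  show (dmk (-1 : 𝔸) 0 * q.snd).snd = -q.snd.snd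
  simp

/-- [folklore] The `τ₂`-flip fixes scalars. -/
@[simp] theorem flip2_ι (a : 𝔸) : flip2 𝕜 (ι a) = ι a := ext4 (by simp) (by simp) (by simp) (by simp)

/-- [folklore] `flip1 (Zf W V) = Zf (−W) V`. -/
theorem flip1_Zf (W V : Form1 d 𝔸) (κ : Fin d) (x : Fin d → ℤ) :
    flip1 (𝕜 := 𝕜) (Zf 𝕜 W V κ x) = Zf 𝕜 (-W) V κ x :=
  ext4 (by simp [Zf]) (by simp [Zf]) (by simp [Zf]) (by simp [Zf, smul_neg, add_comm])

/-- [folklore] `flip1 (Zb W V) = Zb (−W) V`. -/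
theorem flip1_Zb (W V : Form1 d 𝔸) (κ : Fin d) (x : Fin d → ℤ) :
    flip1 (𝕜 := 𝕜) (Zb 𝕜 W V κ x) = Zb 𝕜 (-W) V κ x :=
  ext4 (by simp [Zb]) (by simp [Zb]) (by simp [Zb]) (by simp [Zb, smul_neg, add_comm])

/-- [folklore] `flip2 (Zf W V) = Zf W (−V)`. -/
theorem flip2_Zf (W V : Form1 d 𝔸) (κ : Fin d) (x : Fin d → ℤ) :
    flip2 𝕜 (Zf 𝕜 W V κ x) = Zf 𝕜 W (-V) κ x :=
  ext4 (by simp [Zf]) (by simp [Zf]) (by simp [Zf]) (by simp [Zf, smul_neg, add_comm])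

/-- [folklore] `flip2 (Zb W V) = Zb W (−V)`. -/
theorem flip2_Zb (W V : Form1 d 𝔸) (κ : Fin d) (x : Fin d → ℤ) :
    flip2 𝕜 (Zb 𝕜 W V κ x) = Zb 𝕜 W (-V) κ x :=
  ext4 (by simp [Zb]) (by simp [Zb]) (by simp [Zb]) (by simp [Zb, smul_neg, add_comm])

/-- [folklore] **THE MIXED JET IS ODD IN THE FIRST FLUCTUATION LETTER**: `M(−W, V; B) = −M(W, V; B)`. -/
theorem MjetAt_neg_W (ρ : Fin d → ℤ) (W V B : Form1 d 𝔸) (L : ℕ) (μ : Fin d) (y : Fin d → ℤ) :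
    MjetAt 𝕜 ρ (-W) V B L μ y = -MjetAt 𝕜 ρ W V B L μ y := by
  have h := map_MjetLAt_eq (flip1 (𝕜 := 𝕜)) ρ (Zf 𝕜 W V) (Zb 𝕜 W V) (Zf 𝕜 0 0) (Zb 𝕜 0 0) (upF B) L μ y
  simp only [flip1_Zf, flip1_Zb, neg_zero, upF_apply, flip1_ι, c11_flip1] at h
  rw [MjetAt_eq_MjetLAt, MjetAt_eq_MjetLAt, MjetLAt_eq_c11 ρ (Zf 𝕜 W V) (Zb 𝕜 W V)]
  exact h

/-- [folklore] **THE MIXED JET IS ODD IN THE SECOND FLUCTUATION LETTER**: `M(W, −V; B) = −M(W, V; B)`. -/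
theorem MjetAt_neg_V (ρ : Fin d → ℤ) (W V B : Form1 d 𝔸) (L : ℕ) (μ : Fin d) (y : Fin d → ℤ) :
    MjetAt 𝕜 ρ W (-V) B L μ y = -MjetAt 𝕜 ρ W V B L μ y := by
  have h := map_MjetLAt_eq (flip2 𝕜) ρ (Zf 𝕜 W V) (Zb 𝕜 W V) (Zf 𝕜 0 0) (Zb 𝕜 0 0) (upF B) L μ y
  simp only [flip2_Zf, flip2_Zb, neg_zero, upF_apply, flip2_ι, c11_flip2] at h
  rw [MjetAt_eq_MjetLAt, MjetAt_eq_MjetLAt, MjetLAt_eq_c11 ρ (Zf 𝕜 W V) (Zb 𝕜 W V)]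
  exact h

end Flips

/-! ## §3 Elementary letters under the signed pull-back -/

section Letters

variable {R : Type*} [AddCommGroup R]

/-- [folklore] **THE SIGNED PULL-BACK OF AN ELEMENTARY LETTER IS THE SIGNED ELEMENTARY LETTER ON THE REFLECTED BOND**:
`R1g α (c·δ_f) = (±c)·δ_{f̄}`, sign `−` exactly when `f` is an `α`-bond (twin of an5's real `R1_single`). -/
theorem R1g_single (α : Fin d) (f : Bond d) (c : R) :
    R1g α (single f c) = single (fref α f) (if f.1 = α then -c else c) := by
  funext κ x
  simp only [R1g, single_apply]
  by_cases h : (κ, x) = fref α f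
  · have h1 : κ = f.1 := congrArg Prod.fst h
    have h2 : x = bref α f.1 f.2 := congrArg Prod.snd h
    have h' : (κ, bref α κ x) = f := by rw [h1, h2, bref_bref]
    rw [if_pos h', if_pos h, h1]
  · have h' : (κ, bref α κ x) ≠ f := by
      intro h'
      apply h
      have h1 : κ = f.1 := congrArg Prod.fst h'
      have h2 : bref α κ x = f.2 := congrArg Prod.snd h'
      refine Prod.ext h1 ?_
      show x = bref α f.1 f.2
      rw [← h1, ← h2, bref_bref]
    rw [if_neg h', if_neg h]
    split_ifs <;> simp

/-- [folklore] `R1g` is additive. -/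
theorem R1g_add (α : Fin d) (A B : Form1 d R) : R1g α (A + B) = R1g α A + R1g α B := by
  funext κ x; simp only [R1g, Pi.add_apply]; split_ifs <;> abel

/-- [folklore] `R1g` commutes with negation. -/
theorem R1g_neg (α : Fin d) (A : Form1 d R) : R1g α (-A) = -R1g α A := by
  funext κ x; simp only [R1g, Pi.neg_apply]; split_ifs <;> abel

/-- [folklore] `R1g` is subtractive. -/
theorem R1g_sub (α : Fin d) (A B : Form1 d R) : R1g α (A - B) = R1g α A - R1g α B := by
  rw [sub_eq_add_neg, R1g_add, R1g_neg, ← sub_eq_add_neg]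

/-- [folklore] `R1g` is an involution (`bref ∘ bref = id`, the axis sign squares to `+`). -/
theorem R1g_R1g (α : Fin d) (A : Form1 d R) : R1g α (R1g α A) = A := by
  funext κ x; simp only [R1g]; split_ifs <;> simp [bref_bref]

/-- [folklore] The scalar lift of an elementary letter: `upF (c·δ_f) = (ι c)·δ_f`. -/
theorem upF_single (f : Bond d) (c : 𝔸) : upF (single f c) = single f (ι c : Tau 𝔸) := by
  funext κ x
  rw [upF_apply, single_apply, single_apply]
  split_ifs
  · rfl
  · exact ext4 (by simp) (by simp) (by simp) (by simp)

/-- [folklore] The scalar lift commutes with the signed pull-back: `upF (R1g α B) = R1g α (upF B)` (`ι (−b) = −ι b`). -/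
theorem upF_R1g (α : Fin d) (B : Form1 d 𝔸) : upF (R1g α B) = R1g α (upF B) := by
  funext κ x
  simp only [upF_apply, R1g]
  split_ifs
  · exact ext4 (by simp) (by simp) (by simp) (by simp)
  · rfl

end Letters

end Summit.QuantumFields.BalabanUV.Beta.RootedMixedJetSigns
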